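import Summits.HodgeConjecture.HodgeConjecture.Cruxes.BlochSeedDiscOne.HeightTower
/-!
line stmt-HodgeConjecture-18881 Cruxes/BlochSeedDiscOne/Lines/birth.lean 814a6a70c14e831a stub_rung_pad4_seedAt

# UniformC4Design — a 496-COPY (A1)-clean (A4) integer design with `μ ≠ 0`, rank `8`, on the HEIGHT-6 alphabet:
`Nonex 6 496 8` is FALSE, hence `Nonex h B 8` is false for every `h ≥ 6`, `B ≥ 496`, and `FloorFree 6 B 8` is false for every `B ≥ 496` — KERNEL CERTIFICATE
(planner `plan-lens-HodgeAV-extremal` g16, 2026-08-30, block E2 «vertex structure ∕ one extremal mechanism»; boiler-plate of `RotatedPairA4Design.lean` §1–§2 verbatim).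

STATUS ∕ SCOPE.  Letter-model statements about `DepthBoundA4.Design` only: nothing here is a monad, a source, a SEED or a design of record, and
NOTHING here is proved toward HC ∕ HC_CM ∕ HC_AV ∕ №4 ∕ 26512 ∕ 18881 ∕ H2 — this is an evidence ∕ typed file of an explicit-unit seat, not a rung.
What it decides in the letter model: the height-6 record `B*(6) ≤ 5008` of `RotatedPairA4Design.lean` drops to `B*(6) ≤ 496` (so `199 < B*(6) ≤ 496`
remains open: it does NOT decide `Nonex 6 199 8` or the live node target `FloorFree 6 199 8`; heights `≥ 9` are settled by `RotatedPairB136.lean`).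

THE MECHANISM (one family for all three of this seat's architectures, memo-16 §2): ROTATION-TWISTED TORUS ORBITS.  A UNIFORM CELL is `ℓ⁴ = (ℓ,ℓ,ℓ,ℓ)`;
the diagonal rotation `ρ : β ↦ iβ` acts on letters of fixed level `a`; the design is a ℕ-combination of ORBIT SUMS `Σ_{k<4} (ρᵏℓ)⁴` plus hubs `(6;0,0)⁴`.
WHY (A1) reduces to SIX linear rows: the orbit sum kills every word with `#e ≢ #ē (mod 4)`; on uniform cells every surviving mixed word evaluates to
`|β|²·(e-free monomial)` or `|β|⁴`, so with `b = |β|²`, `c = a² − b` the whole (A1) system is `Σ_classes W·b·q(a,c) = 0` for the six quadratic monomials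
`q ∈ {1, a, c, a², ac, c²}` (net class counts `W = n_N − n_P`): the TYPE MEASURE `b·W` ANNIHILATES QUADRATICS in `(a, selfInt)`.  `μ = 4·Σ W_class·β̄⁴ ≠ 0`
is carried by the Weil-type twist (mirror classes `ℓ, ℓ̄` have equal rows and conjugate `μ`).  (A4): N-classes need `a ≥ 2` and a P-class amply below,
P-classes must be off-axis (then `hub⁴` covers them); hubs also top the rank up to `8`.
THE DESIGN (§3; found as the EXACT OPTIMUM of this family at h = 6, rank ≥ 8, by an LP-bounded branch-and-bound over type patterns — memo-16 §3;
independently re-verified on all 625 words by a stdlib script): N = 16·hub⁴ + Σ_k [30·(ρᵏ(2;2,2))⁴ + 2·(ρᵏ(3;3,0))⁴ + 20·(ρᵏ(4;2,0))⁴ + 7·(ρᵏ(5;1,0))⁴],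
P = Σ_k [(ρᵏ(0;3,3))⁴ + 2·(ρᵏ(1;3,2))⁴ + (ρᵏ(1;4,−1))⁴ + (ρᵏ(2;3,1))⁴ + 54·(ρᵏ(3;2,1))⁴ + 2·(ρᵏ(4;1,1))⁴]: 17 N-cells, 24 P-cells,
copies `496`, rank `8`, `μ = -2688 + 5568·i`, e-free charges `q_d` (d = 0…8) = [8, 120, 1008, 6864, 41664, 235872, 1282752, 6854592, 36637440].

KERNEL-CHECKED HERE (`decide +kernel` on the raw `ℤ × ℤ` evaluator of `T(D)` over all 625 words, and on the flat cell lists):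
* `design_cert : D.OnAlphabet 6 ∧ D.A1 ∧ D.A4 ∧ D.mu ≠ 0 ∧ D.copies = 496 ∧ D.rank = 8`, `mu_eq : D.mu = ⟨-2688, 5568⟩`;
* `not_nonex_six : ¬ Nonex 6 496 8`; `not_nonex : ∀ h ≥ 6, ∀ B ≥ 496, ¬ Nonex h B 8` (shift up, `HeightTower.nonex_of_nonex_up`);
* `not_floorFree_six : ∀ B ≥ 496, ¬ FloorFree 6 B 8` (the P-cell `(0;3,3)⁴` is a floor cell); `exists_design : ∀ h ≥ 6, ∃ E, … ∧ E.copies = 496 ∧ E.rank = 8`.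
FAMILY FACTS (stdlib exact search — complete LP-bounded branch-and-bound, memo-16 §3 — NOT kernel-checked): (i) 496 is the MINIMUM number of copies of
any design `N − P` with `N, P` ℕ-combinations of orbit sums `Σ_k (ρᵏℓ)⁴` and of `hub⁴`, each rotation type `(a, {|x|,|y|})` used on one side only, with
(A1) ∧ (A4) ∧ μ ≠ 0 ∧ rank ≥ 8 on the height-6 alphabet (any number `≥ 0` of hubs); (ii) at h = 7 NO such design — even with a type on both sides — has
fewer than 200 copies; (iii) h = 8: see memo-16 (VERTEX-STRUCTURE-extremal-g16.md).  So this mechanism cannot reach the budget 199 at h ∈ {6, 7}.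
PROVENANCE (irrelevant to validity): memo-16/code/rotpat16.py, rotdfs16.py (search), verify16.py (stdlib check: VALID), gen_lean16.py → this file.
`decide +kernel` only: no `native_decide`, no `sorry`, no `axiom`, no `instance`, no notation, no `set_option allowUnsafeReducibility`.
-/

namespace Summit.HodgeConjecture.HodgeConjecture.Cruxes.BlochSeedDiscOne.UniformC4Design

open Summit.HodgeConjecture.HodgeConjecture.Cruxes.BlochSeedDiscOne.DepthBoundA4
open Summit.HodgeConjecture.HodgeConjecture.Cruxes.BlochSeedDiscOne.IntegralityGap
open Summit.HodgeConjecture.HodgeConjecture.Cruxes.BlochSeedDiscOne.HeightTower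


/-! ## §1 Raw `ℤ[i]` arithmetic and the raw class-tensor evaluator (the `DesignKernel.lean` idiom, for `DepthBoundA4.Design`) -/

/-- product of Gaussian integers written as integer pairs `(re, im)`. -/
def gmul (a b : ℤ × ℤ) : ℤ × ℤ := (a.1 * b.1 - a.2 * b.2, a.1 * b.2 + a.2 * b.1)

/-- the pair as a Gaussian integer. -/
def toG (p : ℤ × ℤ) : GaussianInt := ⟨p.1, p.2⟩

theorem toG_gmul (a b : ℤ × ℤ) : toG (gmul a b) = toG a * toG b := by
  ext
  · simp [toG, gmul, Zsqrtd.re_mul]; ring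
  · simp [toG, gmul, Zsqrtd.im_mul]

/-- force an integer to constructor form before continuing (keeps kernel evaluation of long folds strict). -/
def forceInt {α : Type} (z : ℤ) (k : ℤ → α) : α :=
  match z with
  | Int.ofNat n => k (Int.ofNat n)
  | Int.negSucc n => k (Int.negSucc n)

theorem forceInt_eq {α : Type} (z : ℤ) (k : ℤ → α) : forceInt z k = k z := by
  cases z <;> rfl

/-- raw coefficient of a symbol at a letter: `1 ↦ 1`, `h ↦ a`, `e ↦ β̄`, `ē ↦ β`, `pt ↦ a² − |β|²`. -/
def symv (ℓ : Letter) : Sym → ℤ × ℤ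
  | .one => (1, 0)
  | .h => (ℓ.a, 0)
  | .e => (ℓ.x, -ℓ.y)
  | .ebar => (ℓ.x, ℓ.y)
  | .pt => (ℓ.a * ℓ.a - ℓ.x * ℓ.x - ℓ.y * ℓ.y, 0)

theorem toG_symv (ℓ : Letter) (s : Sym) : toG (symv ℓ s) = s.coef ℓ := by
  cases s <;> (ext <;> (simp [toG, symv, Sym.coef, Letter.beta, Letter.selfInt, Letter.bnorm, pow_two]; try ring))

/-- raw class tensor of one cell at a word. -/
def chRaw (c : Cell) (w : Word) : ℤ × ℤ :=
  gmul (gmul (gmul (symv (c 0) (w 0)) (symv (c 1) (w 1))) (symv (c 2) (w 2))) (symv (c 3) (w 3))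

theorem toG_chRaw (c : Cell) (w : Word) : toG (chRaw c w) = cellCoef c w := by
  simp only [chRaw, toG_gmul, toG_symv, cellCoef, Fin.prod_univ_four]

/-- the list sum `Σ m · cellCoef` (the summand of `Design.T`). -/
def listSum (w : Word) (L : List (Cell × ℕ)) : GaussianInt := (L.map fun cm => (cm.2 : GaussianInt) * cellCoef cm.1 w).sum

theorem listSum_nil (w : Word) : listSum w [] = 0 := by simp [listSum]

theorem listSum_cons (w : Word) (cm : Cell × ℕ) (L : List (Cell × ℕ)) :
    listSum w (cm :: L) = (cm.2 : GaussianInt) * cellCoef cm.1 w + listSum w L := by simp [listSum]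

theorem listSum_append (w : Word) (L M : List (Cell × ℕ)) : listSum w (L ++ M) = listSum w L + listSum w M := by
  simp [listSum, List.map_append, List.sum_append]

theorem T_eq_listSum (E : Design) (w : Word) : E.T w = listSum w E.N - listSum w E.P := rfl

/-- componentwise pair operations (raw `ℤ[i]` addition, subtraction, integer scaling). -/
def padd (a b : ℤ × ℤ) : ℤ × ℤ := (a.1 + b.1, a.2 + b.2)
/-- subtraction. -/
def psub (a b : ℤ × ℤ) : ℤ × ℤ := (a.1 - b.1, a.2 - b.2)
/-- scaling. -/
def pscale (k : ℤ) (a : ℤ × ℤ) : ℤ × ℤ := (k * a.1, k * a.2)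

theorem toG_padd (a b : ℤ × ℤ) : toG (padd a b) = toG a + toG b := by ext <;> simp [toG, padd]
theorem toG_psub (a b : ℤ × ℤ) : toG (psub a b) = toG a - toG b := by ext <;> simp [toG, psub]
theorem toG_pscale (k : ℤ) (a : ℤ × ℤ) : toG (pscale k a) = (k : GaussianInt) * toG a := by
  ext <;> simp [toG, pscale]

/-! ## §2 Boolean list checkers, words, cells -/

/-- every element passes (tail form). -/
def allB {α : Type} : List α → (α → Bool) → Bool
  | [], _ => true
  | x :: l, f => match f x with | true => allB l f | false => false

theorem allB_iff {α : Type} (l : List α) (f : α → Bool) : allB l f = true ↔ ∀ x ∈ l, f x = true := by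
  induction l with
  | nil => simp [allB]
  | cons x l ih =>
    simp only [allB, List.mem_cons, forall_eq_or_imp]
    cases hx : f x <;> simp [ih]

/-- some element passes (tail form). -/
def anyB {α : Type} : List α → (α → Bool) → Bool
  | [], _ => false
  | x :: l, f => match f x with | true => true | false => anyB l f

theorem anyB_iff {α : Type} (l : List α) (f : α → Bool) : anyB l f = true ↔ ∃ x ∈ l, f x = true := by
  induction l with
  | nil => simp [anyB]
  | cons x l ih =>
    simp only [anyB, List.mem_cons, exists_eq_or_imp]
    cases hx : f x <;> simp [ih]

/-- a word from four symbols. -/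
def wordOf (s₀ s₁ s₂ s₃ : Sym) : Word := fun f =>
  match f with
  | ⟨0, _⟩ => s₀
  | ⟨1, _⟩ => s₁
  | ⟨2, _⟩ => s₂
  | ⟨_, _⟩ => s₃

theorem wordOf_eta (w : Word) : wordOf (w 0) (w 1) (w 2) (w 3) = w := by
  funext f
  fin_cases f <;> rfl

/-- a cell from four letters. -/
def cellOf (l₀ l₁ l₂ l₃ : Letter) : Cell := fun f =>
  match f with
  | ⟨0, _⟩ => l₀
  | ⟨1, _⟩ => l₁
  | ⟨2, _⟩ => l₂
  | ⟨_, _⟩ => l₃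

theorem cellCoef_cellOf (a b c d : Letter) (w : Word) :
    cellCoef (cellOf a b c d) w = (w 0).coef a * (w 1).coef b * (w 2).coef c * (w 3).coef d := by
  simp only [cellCoef, Fin.prod_univ_four]
  rfl

/-! ### Product blocks `u^{⊠4}` and the slot-by-slot factorisation of their class tensor -/



/-- the five symbols. -/
def syms : List Sym := [Sym.one, Sym.h, Sym.e, Sym.ebar, Sym.pt]

theorem mem_syms (s : Sym) : s ∈ syms := by
  cases s <;> simp [syms]

/-- all 625 words. -/
def allWords : List Word :=
  syms.flatMap fun a => syms.flatMap fun b => syms.flatMap fun c => syms.map fun d => wordOf a b c d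

theorem mem_allWords (w : Word) : w ∈ allWords := by
  rw [← wordOf_eta w]
  simp only [allWords, List.mem_flatMap, List.mem_map]
  exact ⟨w 0, mem_syms _, w 1, mem_syms _, w 2, mem_syms _, w 3, mem_syms _, rfl⟩

/-- e-free test (raw form of `Word.efree`). -/
def efreeB (w : Word) : Bool := (w 0).efree && (w 1).efree && (w 2).efree && (w 3).efree

theorem efree_of_efreeB {w : Word} (h : efreeB w = true) : w.efree := by
  simp only [efreeB, Bool.and_eq_true] at h
  obtain ⟨⟨⟨h0, h1⟩, h2⟩, h3⟩ := h
  intro f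
  fin_cases f
  · exact h0
  · exact h1
  · exact h2
  · exact h3

theorem efreeB_of_efree {w : Word} (h : w.efree) : efreeB w = true := by
  simp [efreeB, h 0, h 1, h 2, h 3]

/-- Bloch-word test (raw form of `w = eeee ∨ w = ēēēē`). -/
def blochB (w : Word) : Bool :=
  (decide (w 0 = Sym.e) && decide (w 1 = Sym.e) && decide (w 2 = Sym.e) && decide (w 3 = Sym.e)) ||
  (decide (w 0 = Sym.ebar) && decide (w 1 = Sym.ebar) && decide (w 2 = Sym.ebar) && decide (w 3 = Sym.ebar))

theorem bloch_of_blochB {w : Word} (h : blochB w = true) : w = Word.eeee ∨ w = Word.EEEE := by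
  simp only [blochB, Bool.or_eq_true, Bool.and_eq_true, decide_eq_true_eq] at h
  rcases h with ⟨⟨⟨h0, h1⟩, h2⟩, h3⟩ | ⟨⟨⟨h0, h1⟩, h2⟩, h3⟩
  · left; funext f; fin_cases f
    · exact h0
    · exact h1
    · exact h2
    · exact h3
  · right; funext f; fin_cases f
    · exact h0
    · exact h1
    · exact h2
    · exact h3

/-- raw degree. -/
def degB (w : Word) : ℕ := (w 0).deg + (w 1).deg + (w 2).deg + (w 3).deg

theorem deg_eq_degB (w : Word) : w.deg = degB w := by
  simp only [Word.deg, Fin.sum_univ_four, degB]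

/-- raw alphabet test for a letter and a cell (raw form of `Letter.OnAlphabet`). -/
def lettB (h : ℤ) (ℓ : Letter) : Bool := decide (ℓ.a + |ℓ.x| + |ℓ.y| = h ∧ 0 ≤ ℓ.a)

/-- cell on the alphabet. -/
def onAlphaB (h : ℤ) (c : Cell) : Bool := lettB h (c 0) && lettB h (c 1) && lettB h (c 2) && lettB h (c 3)

theorem onAlphabet_of_B {h : ℤ} {c : Cell} (hc : onAlphaB h c = true) : ∀ f : Fin 4, (c f).OnAlphabet h := by
  simp only [onAlphaB, lettB, Bool.and_eq_true, decide_eq_true_eq] at hc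
  obtain ⟨⟨⟨h0, h1⟩, h2⟩, h3⟩ := hc
  intro f
  fin_cases f
  · exact h0
  · exact h1
  · exact h2
  · exact h3

/-- raw ample-above test (squares written as products). -/
def ampleB (ℓ ℓ' : Letter) : Bool :=
  decide (ℓ.a < ℓ'.a) && decide ((ℓ'.x - ℓ.x) * (ℓ'.x - ℓ.x) + (ℓ'.y - ℓ.y) * (ℓ'.y - ℓ.y) < (ℓ'.a - ℓ.a) * (ℓ'.a - ℓ.a))

theorem ampleAbove_of_B {ℓ ℓ' : Letter} (h : ampleB ℓ ℓ' = true) : AmpleAbove ℓ ℓ' := by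
  simp only [ampleB, Bool.and_eq_true, decide_eq_true_eq] at h
  refine ⟨h.1, ?_⟩
  simp only [pow_two]
  exact h.2

/-- raw live test. -/
def liveB (x y : Cell) : Bool := ampleB (x 0) (y 0) && ampleB (x 1) (y 1) && ampleB (x 2) (y 2) && ampleB (x 3) (y 3)

theorem live_of_B {x y : Cell} (h : liveB x y = true) : Live x y := by
  simp only [liveB, Bool.and_eq_true] at h
  obtain ⟨⟨⟨h0, h1⟩, h2⟩, h3⟩ := h
  intro f
  fin_cases f
  · exact ampleAbove_of_B h0
  · exact ampleAbove_of_B h1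
  · exact ampleAbove_of_B h2
  · exact ampleAbove_of_B h3

/-- support membership from an entry with positive multiplicity. -/
theorem mem_suppN_of {D : Design} {c : Cell} {m : ℕ} (h : (c, m) ∈ D.N) (hm : 0 < m) : c ∈ D.suppN :=
  List.mem_map.2 ⟨(c, m), List.mem_filter.2 ⟨h, by simpa using hm⟩, rfl⟩

theorem mem_suppP_of {D : Design} {c : Cell} {m : ℕ} (h : (c, m) ∈ D.P) (hm : 0 < m) : c ∈ D.suppP :=
  List.mem_map.2 ⟨(c, m), List.mem_filter.2 ⟨h, by simpa using hm⟩, rfl⟩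

theorem exists_of_mem_suppN {D : Design} {c : Cell} (h : c ∈ D.suppN) : ∃ m, (c, m) ∈ D.N := by
  obtain ⟨cm, hcm, rfl⟩ := List.mem_map.1 h
  exact ⟨cm.2, (List.mem_filter.1 hcm).1⟩

theorem exists_of_mem_suppP {D : Design} {c : Cell} (h : c ∈ D.suppP) : ∃ m, (c, m) ∈ D.P := by
  obtain ⟨cm, hcm, rfl⟩ := List.mem_map.1 h
  exact ⟨cm.2, (List.mem_filter.1 hcm).1⟩

/-! ## §3 The design: uniform cells `ℓ⁴` on diagonal-`C₄` orbits, plus hubs -/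

/-- the uniform cell `ℓ⁴`. -/
def uni (ℓ : Letter) : Cell := cellOf ℓ ℓ ℓ ℓ

/-- the hub cell `(6;0,0)⁴`. -/
def hub4 : Cell := uni ⟨6, 0, 0⟩

/-- the floor cell `(0;3,3)⁴`. -/
def floor4 : Cell := uni ⟨0, -3, -3⟩

/-- N-list (hub first). -/
def DN : List (Cell × ℕ) :=
  [(hub4, 16),
   (uni ⟨5, -1, 0⟩, 7),
   (uni ⟨5, 0, -1⟩, 7),
   (uni ⟨5, 0, 1⟩, 7),
   (uni ⟨5, 1, 0⟩, 7),
   (uni ⟨4, -2, 0⟩, 20),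
   (uni ⟨4, 0, -2⟩, 20),
   (uni ⟨4, 0, 2⟩, 20),
   (uni ⟨4, 2, 0⟩, 20),
   (uni ⟨3, -3, 0⟩, 2),
   (uni ⟨3, 0, -3⟩, 2),
   (uni ⟨3, 0, 3⟩, 2),
   (uni ⟨3, 3, 0⟩, 2),
   (uni ⟨2, -2, -2⟩, 30),
   (uni ⟨2, -2, 2⟩, 30),
   (uni ⟨2, 2, -2⟩, 30),
   (uni ⟨2, 2, 2⟩, 30)]

/-- P-list (floor cell first). -/
def DP : List (Cell × ℕ) :=
  [(floor4, 1),
   (uni ⟨0, -3, 3⟩, 1),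
   (uni ⟨0, 3, -3⟩, 1),
   (uni ⟨0, 3, 3⟩, 1),
   (uni ⟨1, -4, 1⟩, 1),
   (uni ⟨1, -3, -2⟩, 2),
   (uni ⟨1, -2, 3⟩, 2),
   (uni ⟨1, -1, -4⟩, 1),
   (uni ⟨1, 1, 4⟩, 1),
   (uni ⟨1, 2, -3⟩, 2),
   (uni ⟨1, 3, 2⟩, 2),
   (uni ⟨1, 4, -1⟩, 1),
   (uni ⟨2, -3, -1⟩, 1),
   (uni ⟨2, -1, 3⟩, 1),
   (uni ⟨2, 1, -3⟩, 1),
   (uni ⟨2, 3, 1⟩, 1),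
   (uni ⟨3, -2, -1⟩, 54),
   (uni ⟨3, -1, 2⟩, 54),
   (uni ⟨3, 1, -2⟩, 54),
   (uni ⟨3, 2, 1⟩, 54),
   (uni ⟨4, -1, -1⟩, 2),
   (uni ⟨4, -1, 1⟩, 2),
   (uni ⟨4, 1, -1⟩, 2),
   (uni ⟨4, 1, 1⟩, 2)]

/-- the uniform-`C₄` design. -/
def D : Design := ⟨DN, DP⟩

theorem hub4_mem : (hub4, 16) ∈ D.N := List.mem_cons_self

theorem floor4_mem : (floor4, 1) ∈ D.P := List.mem_cons_self

/-- raw evaluator of a weighted cell list at a word. -/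
def rawList : List (Cell × ℕ) → Word → ℤ × ℤ
  | [], _ => (0, 0)
  | cm :: L, w => padd (pscale (cm.2 : ℤ) (chRaw cm.1 w)) (rawList L w)

theorem toG_zero : toG ((0 : ℤ), (0 : ℤ)) = 0 := by ext <;> simp [toG]

theorem toG_rawList (L : List (Cell × ℕ)) (w : Word) : toG (rawList L w) = listSum w L := by
  induction L with
  | nil => rw [rawList, listSum_nil, toG_zero]
  | cons cm L ih =>
    rw [rawList, toG_padd, toG_pscale, toG_chRaw, ih, listSum_cons]
    push_cast
    ring

/-- raw form of `T(D)(w)`. -/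
def rawT (w : Word) : ℤ × ℤ := psub (rawList DN w) (rawList DP w)

theorem T_raw (w : Word) : D.T w = toG (rawT w) := by
  rw [T_eq_listSum, rawT, toG_psub, toG_rawList, toG_rawList]
  rfl

/-- the e-free charges `q_d = T(D)(w)` for e-free `w` of degree `d`. -/
def qd (d : ℕ) : ℤ :=
  match d with
  | 0 => 8 | 1 => 120 | 2 => 1008 | 3 => 6864 | 4 => 41664 | 5 => 235872 | 6 => 1282752 | 7 => 6854592 | 8 => 36637440 | _ => 0

/-! ## §4 The kernel computations (`decide +kernel`) -/

/-- one row of the (A1) table: e-free words evaluate to `(q_deg, 0)`, every other word except the two Bloch words vanishes. -/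
def a1Row (w : Word) : Bool :=
  bif efreeB w then decide (rawT w = (qd (degB w), 0)) else (blochB w || decide (rawT w = (0, 0)))

theorem a1_table : allB allWords a1Row = true := by decide +kernel

theorem mu_raw : rawT Word.eeee = (-2688, 5568) := by decide +kernel

theorem copies_eq : D.copies = 496 := by decide +kernel

theorem rank_eq : D.rank = 8 := by decide +kernel

theorem posN : allB DN (fun cm => decide (0 < cm.2)) = true := by decide +kernel

theorem posP : allB DP (fun cm => decide (0 < cm.2)) = true := by decide +kernel

theorem alphaN : allB DN (fun cm => onAlphaB 6 cm.1) = true := by decide +kernel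

theorem alphaP : allB DP (fun cm => onAlphaB 6 cm.1) = true := by decide +kernel

/-- (A4).1 witnesses: every P-cell is live below `hub⁴`. -/
theorem a4P : allB DP (fun cm => liveB cm.1 hub4) = true := by decide +kernel

/-- (A4).2 witnesses: every N-cell has a live P-cell below it. -/
theorem a4N : allB DN (fun cn => anyB DP (fun cm => liveB cm.1 cn.1)) = true := by decide +kernel

/-! ## §5 The certificate and its consequences -/

theorem onAlphabet_D : D.OnAlphabet 6 := by
  intro c hc f
  rcases List.mem_append.1 hc with hN | hP
  · obtain ⟨m, hm⟩ := exists_of_mem_suppN hN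
    exact onAlphabet_of_B ((allB_iff _ _).1 alphaN (c, m) hm) f
  · obtain ⟨m, hm⟩ := exists_of_mem_suppP hP
    exact onAlphabet_of_B ((allB_iff _ _).1 alphaP (c, m) hm) f

theorem a1_D : D.A1 := by
  constructor
  · intro w hne h1 h2
    have hr := (allB_iff _ _).1 a1_table w (mem_allWords w)
    unfold a1Row at hr
    cases hb : efreeB w with
    | true => exact (hne (efree_of_efreeB hb)).elim
    | false =>
      rw [hb] at hr
      simp only [cond_false, Bool.or_eq_true, decide_eq_true_eq] at hr
      rcases hr with hbl | hz
      · rcases bloch_of_blochB hbl with h | h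
        · exact (h1 h).elim
        · exact (h2 h).elim
      · rw [T_raw, hz]; ext <;> simp [toG]
  · intro w w' hw hw' hd
    have hr := (allB_iff _ _).1 a1_table w (mem_allWords w)
    have hr' := (allB_iff _ _).1 a1_table w' (mem_allWords w')
    unfold a1Row at hr hr'
    rw [efreeB_of_efree hw] at hr
    rw [efreeB_of_efree hw'] at hr'
    simp only [cond_true, decide_eq_true_eq] at hr hr'
    have hdd : degB w = degB w' := by rw [← deg_eq_degB, ← deg_eq_degB, hd]
    rw [T_raw, T_raw, hr, hr', hdd]

theorem mu_eq : D.mu = ⟨-2688, 5568⟩ := by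
  show D.T Word.eeee = _
  rw [T_raw, mu_raw]
  rfl

theorem mu_ne : D.mu ≠ 0 := by
  rw [mu_eq]
  decide

theorem hub4_suppN : hub4 ∈ D.suppN := mem_suppN_of hub4_mem (by decide)

theorem floor4_suppP : floor4 ∈ D.suppP := mem_suppP_of floor4_mem (by decide)

theorem a4_D : D.A4 := by
  constructor
  · intro x hx
    obtain ⟨m, hm⟩ := exists_of_mem_suppP hx
    exact ⟨hub4, hub4_suppN, live_of_B ((allB_iff _ _).1 a4P (x, m) hm)⟩
  · intro y hy
    obtain ⟨m, hm⟩ := exists_of_mem_suppN hy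
    have h := (allB_iff _ _).1 a4N (y, m) hm
    obtain ⟨cm, hcm, hl⟩ := (anyB_iff _ _).1 h
    have hpos : 0 < cm.2 := of_decide_eq_true ((allB_iff _ _).1 posP cm hcm)
    exact ⟨cm.1, mem_suppP_of hcm hpos, live_of_B hl⟩

/-- THE CERTIFICATE: `D` is an (A1)-clean (A4) design with `μ ≠ 0` on the height-6 alphabet, `496` copies, rank `8`. -/
theorem design_cert : D.OnAlphabet 6 ∧ D.A1 ∧ D.A4 ∧ D.mu ≠ 0 ∧ D.copies = 496 ∧ D.rank = 8 :=
  ⟨onAlphabet_D, a1_D, a4_D, mu_ne, copies_eq, rank_eq⟩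

/-- `Nonex 6 496 8` is false. -/
theorem not_nonex_six : ¬ Nonex 6 496 8 := fun hn =>
  hn D onAlphabet_D a1_D a4_D mu_ne (le_of_eq copies_eq) (le_of_eq rank_eq.symm)

/-- `Nonex h B 8` is false for every height `h ≥ 6` and every budget `B ≥ 496` (shift the design up by `h − 6`). -/
theorem not_nonex (h : ℤ) (hh : 6 ≤ h) (B : ℕ) (hB : 496 ≤ B) : ¬ Nonex h B 8 := by
  intro hn
  have h6 : Nonex (6 + (h - 6)) B 8 := by
    have : (6 : ℤ) + (h - 6) = h := by ring
    rw [this]; exact hn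
  have hn6 : Nonex 6 B 8 := nonex_of_nonex_up (h - 6) (by linarith) h6
  exact hn6 D onAlphabet_D a1_D a4_D mu_ne (by rw [copies_eq]; exact hB) (le_of_eq rank_eq.symm)

/-- `FloorFree 6 B 8` is false for every `B ≥ 496`: the P-cell `(0;3,3)⁴` of `D` is a floor cell. -/
theorem not_floorFree_six (B : ℕ) (hB : 496 ≤ B) : ¬ FloorFree 6 B 8 := by
  intro hf
  have h := hf D onAlphabet_D a1_D a4_D mu_ne (by rw [copies_eq]; exact hB) (le_of_eq rank_eq.symm) floor4
    (List.mem_append.2 (Or.inr floor4_suppP)) 0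
  exact absurd h (by decide)

/-- a `496`-copy rank-8 design exists at every height `≥ 6`. -/
theorem exists_design (h : ℤ) (hh : 6 ≤ h) :
    ∃ E : Design, E.OnAlphabet h ∧ E.A1 ∧ E.A4 ∧ E.mu ≠ 0 ∧ E.copies = 496 ∧ E.rank = 8 := by
  refine ⟨shiftD (h - 6) D, ?_, a1_shiftD (h - 6) D a1_D, a4_shift D (h - 6) a4_D, ?_, ?_, ?_⟩
  · have e : (shiftD (h - 6) D).OnAlphabet (6 + (h - 6)) := onAlphabet_shift_up D 6 (h - 6) (by linarith) onAlphabet_D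
    have : (6 : ℤ) + (h - 6) = h := by ring
    rw [this] at e
    exact e
  · rw [mu_shiftD]; exact mu_ne
  · rw [copies_shift]; exact copies_eq
  · rw [rank_shift]; exact rank_eq

end Summit.HodgeConjecture.HodgeConjecture.Cruxes.BlochSeedDiscOne.UniformC4Design
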